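import Literature.NumberTheory.Automorphic.AsaiSignContOfAsaiHolomorphyMW
import Literature.NumberTheory.Automorphic.PairLFunctionPolesEqConjOfHumphriesJo
import HarnessLib

/-!
# Mok's Asai-pole dichotomy from Grbac–Shahidi's holomorphy and the archimedean Rankin–Selberg
# test vectors of Humphries–Jo — the Rankin–Selberg input of the order count is now ARCHIMEDEAN ONLY

Topic `NumberTheory/Automorphic`; namespace `Literature.NumberTheory.Automorphic`. Proof file
(theorems only: no definition, no named fact, no instance), sibling of
`AsaiSignContOfAsaiHolomorphyMW` under the named fact
`Mok2014_partialAsaiL_continuation_pole_dichotomy` (`AsaiSignCont`; C. P. Mok, Mem. AMS 235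
(2015) no. 1108, §2.5 and Thm. 2.5.4 (a): for a conjugate self-dual cuspidal `Π` on `GL_N(𝔸_E)`,
`E/F` quadratic, exactly one of the partial Asai `L`-functions `L^S(s, Π, As^±)` has a (simple) pole
at `s = 1`, the other being holomorphic and non-zero there, both continued to `{1/2 < Re s}`).

`AsaiSignContOfAsaiHolomorphyMW` proved the fact from TWO named facts of the tree — Grbac–Shahidi
2015, Thm. 4.3 (1), (2)(a) (`GrbacShahidi2015_partialAsaiL_holomorphy`, of which only the holomorphy
clause (2)(a) in `L²_cusp` is used, `hGSa`) and Arthur–Clozel's (2.3), the simple pole of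
`L^S(s, π × π̃)` at `s = 1` (`JacquetShalika1981_partialPairL_pole_of_eq_conj`) over `E` in rank `N`
(`Mok2014_partialAsaiL_continuation_pole_dichotomy_of_GrbacShahidi2015_of_JS`). Since then the tree
has PROVED (2.3) in every rank from ONE archimedean input, the named fact
`HumphriesJo2024_archRankinSelberg_testVector N E` (P. Humphries, Y. Jo, *Test vectors for
archimedean period integrals*, Publ. Mat. 68 (2024), Thm. 1.1 / Thm. 5.6: `K_∞`-finite test vectors
and a polynomial-times-Gaussian `Φ_∞` with `Ψ_∞(s; W_e, W̄_{e'}, Φ_∞) = c^s ∏ Γ_ℝ(s + a_j) ∏ Γ_ℂ(s + b_j)`)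
— the whole global Rankin–Selberg method, the finite bad places and Landau's lemma being theorems
(`JacquetShalika1981_partialPairL_pole_of_eq_conj_of_humphriesJo'`, `PairLFunctionPolesEqConjOfHumphriesJo`).
This file threads that through:

* `Mok2014_partialAsaiL_continuation_pole_dichotomy_of_asaiEntire_of_humphriesJo` — Mok's dichotomy
  from `hGSa` (Grbac–Shahidi (2)(a), holomorphy clause, `L²` currency) and Humphries–Jo's archimedean
  test vectors over every number field in every rank `≥ 3` (ranks `≤ 2` need no Rankin–Selberg
  input at all: (2.3) is there the pole of the partial Dedekind zeta function, resp. the Kirillov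
  first-moment bound, `JacquetShalika1981_partialPairL_pole_of_eq_conj_holds_of_le_two`);
* `Mok2014_partialAsaiL_continuation_pole_dichotomy_of_GrbacShahidi2015_of_humphriesJo` — the same
  from the two NAMED FACTS `GrbacShahidi2015_partialAsaiL_holomorphy` and
  `HumphriesJo2024_archRankinSelberg_testVector` (ranks `≥ 3`);
* `CuspidalAutomorphicRepData.exists_sign_partialAsaiL_continuation_of_asaiEntire_of_humphriesJo`
  — pointwise: for ONE conjugate self-dual cuspidal `Π` on `GL_N(𝔸_E)` the body of the fact follows
  from Grbac–Shahidi's (2)(a) at these `F, E, c, N` and, when `N ≥ 3`, Humphries–Jo in rank `N`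
  over `E`.

So the leaf set of Mok's dichotomy is now `{GrbacShahidi2015_partialAsaiL_holomorphy (2)(a)}` in
ranks `N ≤ 2` and `{GrbacShahidi2015_partialAsaiL_holomorphy (2)(a),
HumphriesJo2024_archRankinSelberg_testVector N E}` in ranks `N ≥ 3`: apart from Grbac–Shahidi's
holomorphy of the partial Asai `L`-functions on the whole plane (Langlands–Shahidi theory on
`U(N, N)` with Mok's classification, or Flicker's Rankin–Selberg integrals — whose archimedean theory
at the places of `F` inert in `E` is again Humphries–Jo, op. cit. §6, Thm. 6.10), every input of the
printed proof is a theorem of the tree or explicit archimedean Whittaker theory.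

## References

* C. P. Mok, *Endoscopic classification of representations of quasi-split unitary groups*, Mem.
  AMS 235 (2015) no. 1108, §2.5 (paragraph before Thm. 2.5.4) and Thm. 2.5.4 (a), p. 20. [Mok2014]
* N. Grbac, F. Shahidi, *Endoscopic transfer for unitary groups and holomorphy of Asai
  `L`-functions*, Pacific J. Math. 276 (2015), Thm. 4.3, pp. 190–191 and 204–206. [GrbacShahidi2015]
* P. Humphries, Y. Jo, *Test vectors for archimedean period integrals*, Publ. Mat. 68 (2024),
  139–185, Thm. 1.1, Thm. 5.6 (Rankin–Selberg), Thm. 6.10 (Flicker). [HumphriesJo2024]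
* J. Arthur, L. Clozel, *Simple algebras, base change, and the advanced theory of the trace
  formula*, Ann. of Math. Stud. 120 (1989), Ch. 3 §2 (2.3). [ArthurClozelAMS120]
-/

noncomputable section

open scoped Topology
open NumberField IsDedekindDomain Filter MeasureTheory

namespace Literature.NumberTheory.Automorphic

open AdelicGroupData

/-! ### Arthur–Clozel (2.3) over `E` in rank `N`: a theorem in ranks `≤ 2`, Humphries–Jo beyond -/

section TwoThree

variable {E : Type} [Field E] [NumberField E] {N : ℕ}

/-- **(2.3) in rank `N` over `E` for every automorphic measure**, from Humphries–Jo's archimedean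
test vectors when `3 ≤ N` and from the tree's theorems when `N ≤ 2`
(`JacquetShalika1981_partialPairL_pole_of_eq_conj_holds_of_le_two`,
`JacquetShalika1981_partialPairL_pole_of_eq_conj_of_humphriesJo'`). [cite: ArthurClozelAMS120, Ch. 3 §2 (2.3)]
[cite: HumphriesJo2024, Thm. 1.1 and Thm. 5.6] -/
theorem JacquetShalika1981_partialPairL_pole_of_eq_conj_of_le_two_or_humphriesJo
    (hHJ : 3 ≤ N → HumphriesJo2024_archRankinSelberg_testVector N E)
    (μ : Measure (gl N E).automorphicQuotient) [(gl N E).IsAutomorphicMeasure μ] :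
    JacquetShalika1981_partialPairL_pole_of_eq_conj (n := N) (K := E) (μ := μ) := by
  by_cases hN2 : N ≤ 2
  · exact JacquetShalika1981_partialPairL_pole_of_eq_conj_holds_of_le_two hN2
  · exact JacquetShalika1981_partialPairL_pole_of_eq_conj_of_humphriesJo' (hHJ (by omega))

end TwoThree

/-! ### Pointwise: one conjugate self-dual `Π` -/

section Datum

variable {F E : Type} [Field F] [NumberField F] [Field E] [NumberField E] [Algebra F E]
  {N : ℕ} {hcpt : isCompact_glFiniteIntegralLevel N E}

/-- **Mok's dichotomy for ONE conjugate self-dual cuspidal `Π` on `GL_N(𝔸_E)` from Grbac–Shahidi's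
(2)(a) at `F, E, c, N` and — only when `N ≥ 3` — Humphries–Jo's archimedean Rankin–Selberg test
vectors in rank `N` over `E`.**  `hGSa`: for every automorphic measure, every cuspidal
`P ≤ L²_cusp(GL_N(E) A_G \ GL_N(𝔸_E))`, every finite `S` off which the `c`-fixed places are inert,
every `L²` Satake family `A` of `P` off `S_E` and sign `η`, `s (s - 1) L^S(s, P, As^η)` is on some
`{σ₀ < Re s}` the restriction of an entire function (Grbac–Shahidi 2015, Thm. 4.3 (2)(a), holomorphy
clause, partial form).  Conclusion: the body of `Mok2014_partialAsaiL_continuation_pole_dichotomy` at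
`Π` (a sign `η` carrying the continued simple pole at `s = 1` at EVERY Asai datum, the opposite sign
holomorphic and non-zero at `1`, both continued to `{1/2 < Re s}`).  Proof:
`exists_sign_partialAsaiL_continuation_of_asaiEntire_of_JS` with (2.3) over `E` in rank `N` from
`JacquetShalika1981_partialPairL_pole_of_eq_conj_of_le_two_or_humphriesJo`.
[cite: Mok2014, §2.5 and Thm. 2.5.4 (a)] [cite: GrbacShahidi2015, Thm. 4.3 (2)(a), pp. 190–191]
[cite: HumphriesJo2024, Thm. 1.1 and Thm. 5.6] -/
theorem CuspidalAutomorphicRepData.exists_sign_partialAsaiL_continuation_of_asaiEntire_of_humphriesJo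
    {c : E ≃ₐ[F] E}
    (hGSa : ∀ (μ : Measure (gl N E).automorphicQuotient) [(gl N E).IsAutomorphicMeasure μ]
      (P : CuspidalAutomorphicRepGL N E μ) (S : Set (HeightOneSpectrum (𝓞 F))) (A : SatakeFamily E)
      (η : ℤˣ), S.Finite →
      IsSatakeFamilyOf P {w : HeightOneSpectrum (𝓞 E) | w.under (𝓞 F) ∈ S} A →
      (∀ w : HeightOneSpectrum (𝓞 E), w.under (𝓞 F) ∉ S → c • w = w →
        w.asIdeal.inertiaDeg (𝓞 F) = 2) →
      ∃ σ₀ : ℝ, 1 ≤ σ₀ ∧ ∃ G : ℂ → ℂ, Differentiable ℂ G ∧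
        ∀ s : ℂ, σ₀ < s.re → G s = s * (s - 1) * partialAsaiL S c A η s)
    (hHJ : 3 ≤ N → HumphriesJo2024_archRankinSelberg_testVector N E)
    (h2 : Module.finrank F E = 2) (hc : c ≠ 1) (hN : 0 < N) (π : CuspidalAutomorphicRepData N E hcpt)
    (hπ : π.1.IsConjSelfDualAE c) :
    ∃ η : ℤˣ, ∀ (S : Set (HeightOneSpectrum (𝓞 F))) (A : SatakeFamily E),
      π.1.IsAsaiDatum c S A →
        ∃ σ₀ : ℝ, 1 ≤ σ₀ ∧
          (∀ (θ : ℤˣ) (s : ℂ), σ₀ < s.re →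
            Multipliable fun v : {v : HeightOneSpectrum (𝓞 F) // v ∉ S} =>
              ((asaiLocalPolynomial c A θ (placeAbove E v.1)).eval
                ((v.1.residueCard : ℂ) ^ (-s)))⁻¹) ∧
          (∃ G : ℂ → ℂ, DifferentiableOn ℂ G {s : ℂ | 1 / 2 < s.re} ∧
            (∀ s : ℂ, σ₀ < s.re → G s = (s - 1) * partialAsaiL S c A η s) ∧ G 1 ≠ 0) ∧
          (∃ H : ℂ → ℂ, DifferentiableOn ℂ H {s : ℂ | 1 / 2 < s.re} ∧
            (∀ s : ℂ, σ₀ < s.re → H s = partialAsaiL S c A (-η) s) ∧ H 1 ≠ 0) :=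
  π.exists_sign_partialAsaiL_continuation_of_asaiEntire_of_JS hGSa
    (fun μ _ => JacquetShalika1981_partialPairL_pole_of_eq_conj_of_le_two_or_humphriesJo hHJ μ)
    h2 hc hN hπ

end Datum

/-! ### Assembly -/

section Assembly

/-- **Mok's Asai-pole dichotomy from Grbac–Shahidi's (2)(a) in `L²_cusp` and Humphries–Jo's
archimedean Rankin–Selberg test vectors (ranks `≥ 3`) — nothing else.**  `hGSa` as in
`Mok2014_partialAsaiL_continuation_pole_dichotomy_of_asaiEntire_of_JS` (Grbac–Shahidi 2015,
Thm. 4.3 (2)(a), holomorphy clause, partial form, `L²` currency, every quadratic `E/F`, every rank);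
`hHJ`: the named fact `HumphriesJo2024_archRankinSelberg_testVector N E` for every number field `E`
and every `N ≥ 3`.  The Rankin–Selberg input of Mok's order count at `s = 1` (Arthur–Clozel's (2.3))
is `JacquetShalika1981_partialPairL_pole_of_eq_conj_of_le_two_or_humphriesJo`.
[cite: Mok2014, §2.5 (paragraph before Thm. 2.5.4) and Thm. 2.5.4 (a), p. 20]
[cite: GrbacShahidi2015, Thm. 4.3 (2)(a), pp. 190–191, proof pp. 204–206]
[cite: HumphriesJo2024, Thm. 1.1 and Thm. 5.6] -/
theorem Mok2014_partialAsaiL_continuation_pole_dichotomy_of_asaiEntire_of_humphriesJo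
    (hGSa : ∀ (F E : Type) [Field F] [NumberField F] [Field E] [NumberField E] [Algebra F E]
      (c : E ≃ₐ[F] E), Module.finrank F E = 2 → c ≠ 1 →
      ∀ (N : ℕ) (μ : Measure (gl N E).automorphicQuotient) [(gl N E).IsAutomorphicMeasure μ]
        (P : CuspidalAutomorphicRepGL N E μ), 0 < N →
        ∀ (S : Set (HeightOneSpectrum (𝓞 F))) (A : SatakeFamily E) (η : ℤˣ), S.Finite →
          IsSatakeFamilyOf P {w : HeightOneSpectrum (𝓞 E) | w.under (𝓞 F) ∈ S} A →
          (∀ w : HeightOneSpectrum (𝓞 E), w.under (𝓞 F) ∉ S → c • w = w →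
            w.asIdeal.inertiaDeg (𝓞 F) = 2) →
          ∃ σ₀ : ℝ, 1 ≤ σ₀ ∧ ∃ G : ℂ → ℂ, Differentiable ℂ G ∧
            ∀ s : ℂ, σ₀ < s.re → G s = s * (s - 1) * partialAsaiL S c A η s)
    (hHJ : ∀ (E : Type) [Field E] [NumberField E] (N : ℕ), 3 ≤ N →
      HumphriesJo2024_archRankinSelberg_testVector N E) :
    Mok2014_partialAsaiL_continuation_pole_dichotomy :=
  Mok2014_partialAsaiL_continuation_pole_dichotomy_of_asaiEntire_of_JS hGSa
    fun E _ _ N μ _ => JacquetShalika1981_partialPairL_pole_of_eq_conj_of_le_two_or_humphriesJo (hHJ E N) μ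

/-- **Mok's dichotomy (`Mok2014_partialAsaiL_continuation_pole_dichotomy`) from the two NAMED FACTS
`GrbacShahidi2015_partialAsaiL_holomorphy` and `HumphriesJo2024_archRankinSelberg_testVector` (the
latter in ranks `≥ 3` only).**  Of Grbac–Shahidi's fact only clause (2)(a) is used; Humphries–Jo's
archimedean test vectors supply Arthur–Clozel's (2.3) over `E` in rank `N ≥ 3`
(`JacquetShalika1981_partialPairL_pole_of_eq_conj_of_humphriesJo'`), ranks `≤ 2` being theorems.
[cite: Mok2014, §2.5 and Thm. 2.5.4 (a), p. 20] [cite: GrbacShahidi2015, Thm. 4.3 (1), (2)(a),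
pp. 190–191, proof pp. 204–206] [cite: HumphriesJo2024, Thm. 1.1 and Thm. 5.6]
[cite: ArthurClozelAMS120, Ch. 3 §2 (2.3)] -/
theorem Mok2014_partialAsaiL_continuation_pole_dichotomy_of_GrbacShahidi2015_of_humphriesJo
    (hGS : GrbacShahidi2015_partialAsaiL_holomorphy)
    (hHJ : ∀ (E : Type) [Field E] [NumberField E] (N : ℕ), 3 ≤ N →
      HumphriesJo2024_archRankinSelberg_testVector N E) :
    Mok2014_partialAsaiL_continuation_pole_dichotomy :=
  Mok2014_partialAsaiL_continuation_pole_dichotomy_of_GrbacShahidi2015_of_JS hGS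
    fun E _ _ N μ _ => JacquetShalika1981_partialPairL_pole_of_eq_conj_of_le_two_or_humphriesJo (hHJ E N) μ

end Assembly

end Literature.NumberTheory.Automorphic

end
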